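import Summits.QuantumFields.BalabanUV.Beta.GAN24.CapacitanceScalarBoundsBorder
import Summits.QuantumFields.BalabanUV.Beta.GAN24.AliasObjects
import Summits.QuantumFields.BalabanUV.Beta.GAN24.CapacitanceClosedForm

/-!
# `BalabanUV.Beta.GAN24.CapacitanceScalarDictionary` — binder row G-an2-4 / (CONV-C), road P1-fibre: the REAL-ZONE DICTIONARY
# «closed-form capacitance scalars of the alias fibre = the real scalar alias sums» and the crux bounds INSTANTIATED
# (sequel of typer row P1-Y08s; nodes N09/N10 of SKELETON-P1)

NOT IN PRINT; OUR PROOF ATTEMPT.  HONEST FRAMING (cell contract, verbatim): «discharging `BetaPertH` makes Bałaban's UV stability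
UNCONDITIONAL — a real constructive-QFT result; it is NOT the continuum limit and NOT the Clay problem.»  HONEST DEPENDENCY (verbatim):
«continuum YM on T⁴ ⇐ BetaPertH ∧ nine spine estimates (0/9 proved); BetaPertH ⇐ (D1) ∧ (D4) ∧ CAP+tail; G-an2-4 gates asym, D1 and
NE2/3/4.»  [folklore] bookkeeping + the explicit estimates of `GAN24/CapacitanceScalarBounds(Border)`; it discharges NOTHING of (CONV-C)'s
K-slot `GAN24.CombesThomas.ConvCK 3 Lc` by itself.  NOT `BetaPertH`, NOT continuum, NOT Clay.  No `def`, no `def … : Prop`, no cited fact,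
no wall binder; «not in print; our proof attempt».

## What is proved (every `D`, `N ≥ 1`, real Brillouin momentum `p = ofRealVec q`)
* §1 POINTWISE DICTIONARY between the complex alias objects of typer row P1-T00 (`GAN24/AliasObjects`: `kFine`/`kAl`, `sAl`, `sbAl`, `SAl`,
  `wAl`, `LAl`, index `TorusSite D N = Fin D → ZMod N`) and the real currency of leaves P1-L06 / P1-Y08s (`AliasWeights.kfine`,
  `CapacitanceScalarBounds.gNormSq`, `blockWt`, `AliasWeightsSum.lapR`): `kFine_ofRealVec`, `norm_sq_sAl`, `sAl_mul_sbAl`, `normSq_SAl`,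
  `wAl_ofRealVec` (`w_m = ↑(blockWt)`), `LAl_ofRealVec` (`L_m = ↑(lapR)`), and `LAl_ofRealVec_ne_zero`: at `q ∈ [−π, π]^D ∖ {0}` EVERY alias
  is regular (`L_m ≠ 0`), so T00's `fibreAl N p h` exists with `h` discharged.
* §2 THE THREE SCALARS of the closed form (typer row P1-Y08f, `GAN24/CapacitanceClosedForm`) on the alias fibre ARE the real sums:
  **`aDiag (fibreAl N p h) κ = ↑(capDiag N q κ)`**, **`sigma (fibreAl N p h) = ↑(capBorder N q)`**,
  **`hSum (aDiag (fibreAl N p h)) (dhat p) (dflat p) = ↑(capH N q)`**.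
* §3 The §6 HYPOTHESES of `CapacitanceClosedForm` DISCHARGED at real `p ≠ 0`, uniformly in `N` (constants of P1-Y08s):
  `‖(a_κ)⁻¹‖ ≤ α := 2|q|²/((4/π²)^{D+1}N^{D+4})`, `‖σ⁻¹‖ ≤ ς := |q|⁴/((4/π²)^D N^{D+4})`,
  `‖h⁻¹‖ ≤ η := N^{D+4}(π²/(8|q|²) + aliasWtConst D/2)/((4/π²)|q|²)`, `‖δ_κ‖, ‖δ'_κ‖ ≤ ε := √|q|²` (`δ = dhat p`, `δ' = dflat p`).
* §4 THE CRUX BOUNDS INSTANTIATED (A4 `cap_lower` in closed-form currency, NO cancellation): the four blocks `invPP`, `invPc`, `invcP`,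
  `invcc` of the explicit inverse of `[[diag(a) − (σ/2)δδ'ᵀ, σδ],[σδ'ᵀ, 0]]` with `a = aDiag (fibreAl N p h)`, `σ = sigma (fibreAl N p h)`
  obey `‖invPP κ l‖ ≤ α + α²ε²η` (= O(|p|²/N^{D+4})), `‖invPc κ‖, ‖invcP l‖ ≤ αεςη` (= O(|p|³/N^{D+4})), `‖invcc‖ ≤ ς/2 + ς²η`
  (= O(|p|⁴/N^{D+4})) at EVERY `N ≥ 1` and every `q ∈ [−π, π]^D ∖ {0}` — `Y08f §6 ∘ Y08s`.  What remains for p1's row L08 on the matrix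
  `cap N p` itself is ONLY the identification of `cap N p` with this closed form, i.e. the telescoping identities (T1)/(T2) for
  `fibreAl` (typer row P1-T00 part 2 / p1 row L05(b)) — not asserted here.

Unit `b2b-balaban-gan24-formalise-leaf-12` (G-an2-4 formalisation swarm, leaf prover 12), 2026-08-19.  Value = kernel bookkeeping + estimate
instantiation toward the K-slot route P1, NOT summit progress.
-/

noncomputable section

open Complex Finset
open scoped BigOperators Real ComplexConjugate

namespace Summit.QuantumFields.BalabanUV.Beta.GAN24.CapacitanceScalarDictionary

open Literature.Probability.LatticeModels (TorusSite)
open Literature.MathematicalPhysics.QuantumFieldTheory.LatticeForm (repZ)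
open Literature.MathematicalPhysics.QuantumFieldTheory.Balaban1983to89.B4Strip (ofRealVec)
open Literature.MathematicalPhysics.QuantumFieldTheory.King1986 (momSq momSq_nonneg)
open FibreSymbols (dhat dflat lapSym)
open FibreDFT (kFine)
open AliasWeights AliasWeightsSum CapacitanceScalarBounds CapacitanceScalarBoundsBorder AliasObjects
open CapacitanceClosedForm (aDiag sigma hSum invPP invPc invcP invcc norm_invPP_le norm_invPc_le norm_invcP_le norm_invcc_le)

variable {D : ℕ} {N : ℕ} [NeZero N]

/-! ## §1  Pointwise dictionary at real momentum -/

omit [NeZero N] in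
/-- [folklore] The complex fine momentum at a real Brillouin momentum is the real fine momentum of leaf P1-L06:
`kFine (ofRealVec q) m μ = ↑((q_μ + 2π·val(m_μ))/N)`. -/
theorem kFine_ofRealVec (q : Fin D → ℝ) (m : TorusSite D N) (μ : Fin D) :
    kFine (ofRealVec q) m μ = ((kfine N q m μ : ℝ) : ℂ) := by
  show (ofRealVec q μ + 2 * π * (repZ m μ : ℂ)) / (N : ℂ) = _
  simp only [kfine, SymbolTaylor.ofRealVec_apply, repZ, Int.cast_natCast]
  push_cast
  ring

/-- [folklore] The vector form: `kAl N (ofRealVec q) m = fun μ => ↑(kfine N q m μ)`. -/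
theorem kAl_ofRealVec (q : Fin D → ℝ) (m : TorusSite D N) :
    kAl N (ofRealVec q) m = fun μ => ((kfine N q m μ : ℝ) : ℂ) :=
  funext fun μ => kFine_ofRealVec q m μ

/-- [folklore] `‖s_κ(m)‖² = gNormSq N k_{m,κ}` at real momentum. -/
theorem norm_sq_sAl (q : Fin D → ℝ) (m : TorusSite D N) (κ : Fin D) :
    ‖sAl N (ofRealVec q) m κ‖ ^ 2 = gNormSq N (kfine N q m κ) := by
  unfold sAl gs gNormSq
  rw [show kAl N (ofRealVec q) m κ = ((kfine N q m κ : ℝ) : ℂ) from kFine_ofRealVec q m κ]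

/-- [folklore] `s_κ(m)·s♭_κ(m) = ↑(gNormSq N k_{m,κ})` at real momentum (`s♭ = conj s`). -/
theorem sAl_mul_sbAl (q : Fin D → ℝ) (m : TorusSite D N) (κ : Fin D) :
    sAl N (ofRealVec q) m κ * sbAl N (ofRealVec q) m κ = ((gNormSq N (kfine N q m κ) : ℝ) : ℂ) := by
  rw [sbAl_eq_conj (conj_ofRealVec q) m κ, Complex.mul_conj, Complex.normSq_eq_norm_sq, norm_sq_sAl]

/-- [folklore] `|S(m)|² = Π_i gNormSq N k_{m,i}` at real momentum. -/
theorem normSq_SAl (q : Fin D → ℝ) (m : TorusSite D N) :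
    Complex.normSq (SAl N (ofRealVec q) m) = ∏ i, gNormSq N (kfine N q m i) := by
  unfold SAl
  rw [map_prod]
  exact Finset.prod_congr rfl fun i _ => by rw [Complex.normSq_eq_norm_sq, norm_sq_sAl]

/-- [folklore] **The alias weight is the block weight**: `wAl N (ofRealVec q) m = ↑(blockWt N q m)` (`= |S(m)|²/N^D`). -/
theorem wAl_ofRealVec (q : Fin D → ℝ) (m : TorusSite D N) :
    wAl N (ofRealVec q) m = ((blockWt N q m : ℝ) : ℂ) := by
  rw [wAl_eq_normSq (conj_ofRealVec q), normSq_SAl]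
  rfl

/-- [folklore] **The Laplacian symbol is `lapR`**: `LAl N (ofRealVec q) m = ↑(lapR k_m)`. -/
theorem LAl_ofRealVec (q : Fin D → ℝ) (m : TorusSite D N) :
    LAl N (ofRealVec q) m = ((lapR (kfine N q m) : ℝ) : ℂ) := by
  show lapSym (kAl N (ofRealVec q) m) = _
  rw [kAl_ofRealVec]
  exact lapSym_ofReal (kfine N q m)

/-- [folklore] **Every alias is regular at a nonzero real Brillouin momentum**: `L_m ≠ 0` for all `m` (`N ≥ 1`, `q ∈ [−π, π]^D`,
`q ≠ 0`) — the hypothesis `h` of T00's `fibreAl N p h` discharged on the punctured real zone. -/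
theorem LAl_ofRealVec_ne_zero (hN : 1 ≤ N) {q : Fin D → ℝ} (hq : ∀ i, |q i| ≤ π) (hq0 : q ≠ 0) (m : TorusSite D N) :
    LAl N (ofRealVec q) m ≠ 0 := by
  rw [LAl_ofRealVec]
  by_cases hm : m = 0
  · subst hm
    exact_mod_cast (lapR_zero_pos hN hq hq0).ne'
  · exact_mod_cast (lapR_pos_of_ne_zero hq hm).ne'

/-- [folklore] The coarse symbols at real momentum are bounded by `√|q|²`: `‖dhat (ofRealVec q) κ‖ ≤ √(momSq q)`. -/
theorem norm_dhat_ofRealVec_le_sqrt (q : Fin D → ℝ) (κ : Fin D) : ‖dhat (ofRealVec q) κ‖ ≤ Real.sqrt (momSq q) := by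
  refine (SymbolTaylor.norm_dhat_ofRealVec_le q κ).trans ?_
  rw [← Real.sqrt_sq_eq_abs]
  exact Real.sqrt_le_sqrt (Finset.single_le_sum (f := fun i => q i ^ 2) (fun i _ => sq_nonneg _) (Finset.mem_univ κ))

/-- [folklore] `‖dflat (ofRealVec q) κ‖ ≤ √(momSq q)` (`dflat = conj dhat` at real momentum). -/
theorem norm_dflat_ofRealVec_le_sqrt (q : Fin D → ℝ) (κ : Fin D) : ‖dflat (ofRealVec q) κ‖ ≤ Real.sqrt (momSq q) := by
  have h : dflat (ofRealVec q) κ = conj (dhat (ofRealVec q) κ) :=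
    FibreGaffney.dflat_eq_conj_dhat (fun μ => conj_ofRealVec q μ) κ
  rw [h, Complex.norm_conj]
  exact norm_dhat_ofRealVec_le_sqrt q κ

/-! ## §2  The closed-form scalars of the alias fibre are the real scalar sums -/

/-- **DICTIONARY `a_κ`.**  On the alias fibre at real momentum, the diagonal closed-form scalar of `CapacitanceClosedForm` is the real
alias sum of P1-Y08s: `aDiag (fibreAl N (ofRealVec q) h) κ = ↑(capDiag N q κ)`. [folklore] -/
theorem aDiag_fibreAl (q : Fin D → ℝ) (h : ∀ m, LAl N (ofRealVec q) m ≠ 0) (κ : Fin D) :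
    aDiag (fibreAl N (ofRealVec q) h) κ = ((capDiag N q κ : ℝ) : ℂ) := by
  unfold aDiag capDiag
  push_cast
  refine Finset.sum_congr rfl fun m _ => ?_
  show SAl N (ofRealVec q) m * sAl N (ofRealVec q) m κ * (chiAl N (ofRealVec q) m * sbAl N (ofRealVec q) m κ)
      / (2 * LAl N (ofRealVec q) m) = _
  rw [show SAl N (ofRealVec q) m * sAl N (ofRealVec q) m κ * (chiAl N (ofRealVec q) m * sbAl N (ofRealVec q) m κ)
      = wAl N (ofRealVec q) m * (sAl N (ofRealVec q) m κ * sbAl N (ofRealVec q) m κ) by unfold wAl; ring,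
    wAl_ofRealVec, sAl_mul_sbAl, LAl_ofRealVec]

/-- **DICTIONARY `σ`.**  `sigma (fibreAl N (ofRealVec q) h) = ↑(capBorder N q)`. [folklore] -/
theorem sigma_fibreAl (q : Fin D → ℝ) (h : ∀ m, LAl N (ofRealVec q) m ≠ 0) :
    sigma (fibreAl N (ofRealVec q) h) = ((capBorder N q : ℝ) : ℂ) := by
  unfold sigma capBorder
  push_cast
  refine Finset.sum_congr rfl fun m _ => ?_
  show SAl N (ofRealVec q) m * chiAl N (ofRealVec q) m / LAl N (ofRealVec q) m ^ 2 = _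
  rw [show SAl N (ofRealVec q) m * chiAl N (ofRealVec q) m = wAl N (ofRealVec q) m from rfl, wAl_ofRealVec, LAl_ofRealVec]

/-- **DICTIONARY `h`.**  With the COARSE symbols `δ = dhat p`, `δ' = dflat p` at `p = ofRealVec q`:
`hSum (aDiag (fibreAl N p h)) δ δ' = ↑(capH N q)` (`δ_κ δ'_κ = 4 sin²(q_κ/2)`). [folklore] -/
theorem hSum_fibreAl (q : Fin D → ℝ) (h : ∀ m, LAl N (ofRealVec q) m ≠ 0) :
    hSum (aDiag (fibreAl N (ofRealVec q) h)) (dhat (ofRealVec q)) (dflat (ofRealVec q)) = ((capH N q : ℝ) : ℂ) := by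
  unfold hSum capH
  push_cast
  refine Finset.sum_congr rfl fun κ _ => ?_
  rw [aDiag_fibreAl, SymbolTaylor.dhat_mul_dflat_self_ofRealVec]
  push_cast
  ring

/-! ## §3  The §6 hypotheses of `CapacitanceClosedForm` discharged at real momentum, uniformly in `N` -/

/-- [folklore] The norm of the inverse of a positive real, seen in `ℂ`, is the inverse. -/
theorem norm_inv_ofReal_of_pos {x : ℝ} (hx : 0 < x) : ‖((x : ℝ) : ℂ)⁻¹‖ = x⁻¹ := by
  rw [norm_inv, Complex.norm_real, Real.norm_eq_abs, abs_of_pos hx]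

/-- **`α` DISCHARGED**: `‖(a_κ)⁻¹‖ ≤ 2|q|²/((4/π²)^{D+1} N^{D+4})` for every `N ≥ 1`, `q ∈ [−π, π]^D ∖ {0}`. [folklore] -/
theorem norm_inv_aDiag_le (hN : 1 ≤ N) {q : Fin D → ℝ} (hq : ∀ i, |q i| ≤ π) (hq0 : q ≠ 0)
    (h : ∀ m, LAl N (ofRealVec q) m ≠ 0) (κ : Fin D) :
    ‖(aDiag (fibreAl N (ofRealVec q) h) κ)⁻¹‖ ≤ 2 * momSq q / ((4 / π ^ 2) ^ (D + 1) * (N : ℝ) ^ (D + 4)) := by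
  rw [aDiag_fibreAl, norm_inv_ofReal_of_pos (capDiag_pos hN hq hq0 κ)]
  exact inv_capDiag_le hN hq hq0 κ

/-- **`ς` DISCHARGED**: `‖σ⁻¹‖ ≤ |q|⁴/((4/π²)^D N^{D+4})`. [folklore] -/
theorem norm_inv_sigma_le (hN : 1 ≤ N) {q : Fin D → ℝ} (hq : ∀ i, |q i| ≤ π) (hq0 : q ≠ 0)
    (h : ∀ m, LAl N (ofRealVec q) m ≠ 0) :
    ‖(sigma (fibreAl N (ofRealVec q) h))⁻¹‖ ≤ momSq q ^ 2 / ((4 / π ^ 2) ^ D * (N : ℝ) ^ (D + 4)) := by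
  rw [sigma_fibreAl, norm_inv_ofReal_of_pos (capBorder_pos hN hq hq0)]
  exact inv_capBorder_le hN hq hq0

/-- **`η` DISCHARGED**: `‖h⁻¹‖ ≤ N^{D+4}(π²/(8|q|²) + aliasWtConst D/2)/((4/π²)|q|²)`. [folklore] -/
theorem norm_inv_hSum_le (hN : 1 ≤ N) {q : Fin D → ℝ} (hq : ∀ i, |q i| ≤ π) (hq0 : q ≠ 0)
    (h : ∀ m, LAl N (ofRealVec q) m ≠ 0) :
    ‖(hSum (aDiag (fibreAl N (ofRealVec q) h)) (dhat (ofRealVec q)) (dflat (ofRealVec q)))⁻¹‖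
      ≤ (N : ℝ) ^ (D + 4) * (π ^ 2 / (8 * momSq q) + aliasWtConst D / 2) / (4 / π ^ 2 * momSq q) := by
  rw [hSum_fibreAl, norm_inv_ofReal_of_pos (capH_pos hN hq hq0)]
  exact inv_capH_le hN hq hq0

/-! ## §4  The crux bounds instantiated: the four blocks of the explicit inverse at every `N` -/

/-- **`φφ`-BLOCK (A4 `cap_lower`, no cancellation).**  For every `N ≥ 1` and `q ∈ [−π, π]^D ∖ {0}`, with `p = ofRealVec q`,
`a = aDiag (fibreAl N p h)`, `δ = dhat p`, `δ' = dflat p`: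
`‖invPP a δ δ' κ l‖ ≤ α + α²·|q|²·η`, `α = 2|q|²/((4/π²)^{D+1}N^{D+4})`, `η = N^{D+4}(π²/(8|q|²) + aliasWtConst D/2)/((4/π²)|q|²)`
— of order `|q|²/N^{D+4}` uniformly in `N` (A4′(iii): `(Cap⁻¹)_φφ ≈ 2(|p|²·1 − ppᵀ)/N^{D+4}`). [folklore] -/
theorem norm_invPP_fibreAl_le (hN : 1 ≤ N) {q : Fin D → ℝ} (hq : ∀ i, |q i| ≤ π) (hq0 : q ≠ 0)
    (h : ∀ m, LAl N (ofRealVec q) m ≠ 0) (κ l : Fin D) :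
    ‖invPP (aDiag (fibreAl N (ofRealVec q) h)) (dhat (ofRealVec q)) (dflat (ofRealVec q)) κ l‖
      ≤ 2 * momSq q / ((4 / π ^ 2) ^ (D + 1) * (N : ℝ) ^ (D + 4))
        + (2 * momSq q / ((4 / π ^ 2) ^ (D + 1) * (N : ℝ) ^ (D + 4))) ^ 2 * Real.sqrt (momSq q) ^ 2
          * ((N : ℝ) ^ (D + 4) * (π ^ 2 / (8 * momSq q) + aliasWtConst D / 2) / (4 / π ^ 2 * momSq q)) :=
  norm_invPP_le _ _ _ (norm_inv_aDiag_le hN hq hq0 h) (norm_dhat_ofRealVec_le_sqrt q) (norm_dflat_ofRealVec_le_sqrt q)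
    (norm_inv_hSum_le hN hq hq0 h) κ l

/-- **`φc`-COLUMN.**  `‖invPc a δ δ' σ κ‖ ≤ α·√|q|²·ς·η` with `ς = |q|⁴/((4/π²)^D N^{D+4})` — of order `|q|³/N^{D+4}` uniformly in `N`
(A4′(iii): `(Cap⁻¹)_φc ≈ i p|p|²/N^{D+4}`). [folklore] -/
theorem norm_invPc_fibreAl_le (hN : 1 ≤ N) {q : Fin D → ℝ} (hq : ∀ i, |q i| ≤ π) (hq0 : q ≠ 0)
    (h : ∀ m, LAl N (ofRealVec q) m ≠ 0) (κ : Fin D) :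
    ‖invPc (aDiag (fibreAl N (ofRealVec q) h)) (dhat (ofRealVec q)) (dflat (ofRealVec q))
        (sigma (fibreAl N (ofRealVec q) h)) κ‖
      ≤ 2 * momSq q / ((4 / π ^ 2) ^ (D + 1) * (N : ℝ) ^ (D + 4)) * Real.sqrt (momSq q)
          * (momSq q ^ 2 / ((4 / π ^ 2) ^ D * (N : ℝ) ^ (D + 4)))
          * ((N : ℝ) ^ (D + 4) * (π ^ 2 / (8 * momSq q) + aliasWtConst D / 2) / (4 / π ^ 2 * momSq q)) :=
  norm_invPc_le _ _ _ _ (norm_inv_aDiag_le hN hq hq0 h) (norm_dhat_ofRealVec_le_sqrt q) (norm_inv_sigma_le hN hq hq0 h)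
    (norm_inv_hSum_le hN hq hq0 h) κ

/-- **`cφ`-ROW.**  `‖invcP a δ δ' σ l‖ ≤ α·√|q|²·ς·η` — of order `|q|³/N^{D+4}` uniformly in `N`. [folklore] -/
theorem norm_invcP_fibreAl_le (hN : 1 ≤ N) {q : Fin D → ℝ} (hq : ∀ i, |q i| ≤ π) (hq0 : q ≠ 0)
    (h : ∀ m, LAl N (ofRealVec q) m ≠ 0) (l : Fin D) :
    ‖invcP (aDiag (fibreAl N (ofRealVec q) h)) (dhat (ofRealVec q)) (dflat (ofRealVec q))
        (sigma (fibreAl N (ofRealVec q) h)) l‖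
      ≤ 2 * momSq q / ((4 / π ^ 2) ^ (D + 1) * (N : ℝ) ^ (D + 4)) * Real.sqrt (momSq q)
          * (momSq q ^ 2 / ((4 / π ^ 2) ^ D * (N : ℝ) ^ (D + 4)))
          * ((N : ℝ) ^ (D + 4) * (π ^ 2 / (8 * momSq q) + aliasWtConst D / 2) / (4 / π ^ 2 * momSq q)) :=
  norm_invcP_le _ _ _ _ (norm_inv_aDiag_le hN hq hq0 h) (norm_dflat_ofRealVec_le_sqrt q) (norm_inv_sigma_le hN hq hq0 h)
    (norm_inv_hSum_le hN hq hq0 h) l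

/-- **`cc`-CORNER (no cancellation).**  `‖invcc a δ δ' σ‖ ≤ ς/2 + ς²η` — of order `|q|⁴/N^{D+4}` uniformly in `N` (the finer
`|p|⁶` of A4′(iii) needs the cancellation `σh → 2`, typer row P1-Y08cc, not used here). [folklore] -/
theorem norm_invcc_fibreAl_le (hN : 1 ≤ N) {q : Fin D → ℝ} (hq : ∀ i, |q i| ≤ π) (hq0 : q ≠ 0)
    (h : ∀ m, LAl N (ofRealVec q) m ≠ 0) :
    ‖invcc (aDiag (fibreAl N (ofRealVec q) h)) (dhat (ofRealVec q)) (dflat (ofRealVec q))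
        (sigma (fibreAl N (ofRealVec q) h))‖
      ≤ momSq q ^ 2 / ((4 / π ^ 2) ^ D * (N : ℝ) ^ (D + 4)) / 2
          + (momSq q ^ 2 / ((4 / π ^ 2) ^ D * (N : ℝ) ^ (D + 4))) ^ 2
            * ((N : ℝ) ^ (D + 4) * (π ^ 2 / (8 * momSq q) + aliasWtConst D / 2) / (4 / π ^ 2 * momSq q)) :=
  norm_invcc_le _ _ _ _ (norm_inv_sigma_le hN hq hq0 h) (norm_inv_hSum_le hN hq hq0 h)

end Summit.QuantumFields.BalabanUV.Beta.GAN24.CapacitanceScalarDictionary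

end
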